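import Summits.MatrixMultiplication.MatrixMultiplication.Theorems.ObstructionDescentPolarExpand

/- `set_option linter.dupNamespace false` as in the sibling kernel files (namespace `…Theorems.<FileStem>`). -/
set_option linter.dupNamespace false

/-!
# Obstruction descent — the prefix form and its re-polarisation (K3b)

Second part of the bridge deciding the aside `GapPropagation` (route `ObstructionDescent`,
item 27779; memo NODE-g23 §3, Theorem C).  Freeze the first `p` slots of the polar form
`P_f(y_1,…,y_{p+n})` of a polynomial `f` on `ℂ^N ⊗ ℂ^N ⊗ ℂ^N` at tensors `a_1,…,a_p` and let the
last `n` slots vary: the PREFIX FORM `D(b) = P_f(a_1,…,a_p,b_1,…,b_n)` (`prefixMultilinear`) is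
multilinear and symmetric in `b`.  Its diagonal is a genuine polynomial, the PREFIX POLYNOMIAL
`g = prefixPoly f a n` of degree `n` (`prefixPoly_isHomogeneous`, `aeval_prefixPoly`:
`g(x) = D(x,…,x)`), and the RE-POLARISATION IDENTITY `P_g(b) = n! · D(b)` (`polarForm_prefixPoly`,
proved with the permanent lemma of K3a) shows that `g = 0` forces `D ≡ 0`
(`append_eq_zero_of_prefixPoly`).  This is what lets an abstract "gap-one" emptiness statement
about POLYNOMIALS of degree `n` act on the frozen-prefix slices of a polar form.

[this cell; classical polarisation in characteristic 0, cf. LandsbergManivel2004 §3, Raicu2012 Prop. 3.4]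
-/

namespace Summit.MatrixMultiplication.MatrixMultiplication.Theorems.ObstructionDescentPrefixForm

open MvPolynomial Finset
open ObstructionDescentPolarForm ObstructionDescentPolarLinear ObstructionDescentPolarExpand

variable {N p n : ℕ}

/-- Updating a free slot commutes with appending the prefix. [this cell] -/
theorem append_update {α : Type*} [DecidableEq (Fin n)] (a : Fin p → α) (b : Fin n → α) (l : Fin n) (u : α) :
    Fin.append a (Function.update b l u) = Function.update (Fin.append a b) (Fin.natAdd p l) u := by
  funext k
  induction k using Fin.addCases with
  | left i =>
    have hne : (Fin.castAdd n i : Fin (p + n)) ≠ Fin.natAdd p l := by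
      intro h
      have := congrArg Fin.val h
      simp at this
      omega
    rw [Fin.append_left, Function.update_of_ne hne, Fin.append_left]
  | right j =>
    rw [Fin.append_right]
    by_cases h : j = l
    · subst h
      rw [Function.update_self, Function.update_self]
    · have hne : (Fin.natAdd p j : Fin (p + n)) ≠ Fin.natAdd p l := fun h' => h ((Fin.natAdd_inj p).mp h')
      rw [Function.update_of_ne h, Function.update_of_ne hne, Fin.append_right]

/-- THE PREFIX FORM `D(b) = P_f(a_1,…,a_p,b_1,…,b_n)` as a multilinear map in the free slots.
[this cell] -/
noncomputable def prefixMultilinear (f : MvPolynomial (Pt N) ℂ) (a : Fin p → Pt N → ℂ) (n : ℕ) :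
    MultilinearMap ℂ (fun _ : Fin n => Pt N → ℂ) ℂ where
  toFun b := polarForm f (Fin.append a b)
  map_update_add' := by
    intro _ b l u u'
    have h := (polarMultilinear f (p + n)).map_update_add (Fin.append a b) (Fin.natAdd p l) u u'
    simp only [polarMultilinear_apply, ← append_update] at h
    convert h using 2
  map_update_smul' := by
    intro _ b l c u
    have h := (polarMultilinear f (p + n)).map_update_smul (Fin.append a b) (Fin.natAdd p l) c u
    simp only [polarMultilinear_apply, ← append_update] at h
    convert h using 2

/-- The prefix form evaluates to the polar form of the appended tuple. [this cell] -/
@[simp] theorem prefixMultilinear_apply (f : MvPolynomial (Pt N) ℂ) (a : Fin p → Pt N → ℂ)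
    (b : Fin n → Pt N → ℂ) : prefixMultilinear f a n b = polarForm f (Fin.append a b) := rfl

/-- Expansion of the prefix form at a sum in all free slots:
`D(ΣT,…,ΣT) = Σ_{σ : [n] → [r]} D(T_{σ 1},…,T_{σ n})`. [this cell] -/
theorem prefix_map_sum (f : MvPolynomial (Pt N) ℂ) (a : Fin p → Pt N → ℂ) {r : ℕ}
    (T : Fin r → Pt N → ℂ) :
    polarForm f (Fin.append a (fun _ : Fin n => ∑ j, T j))
      = ∑ σ : Fin n → Fin r, polarForm f (Fin.append a (fun l => T (σ l))) := by
  have h := MultilinearMap.map_sum (prefixMultilinear f a n) (fun (_ : Fin n) (j : Fin r) => T j)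
  simpa only [prefixMultilinear_apply] using h

/-- Symmetry of the prefix form in the free slots. [this cell; `polarForm_perm`] -/
theorem polarForm_append_perm (f : MvPolynomial (Pt N) ℂ) (a : Fin p → Pt N → ℂ)
    (b : Fin n → Pt N → ℂ) (τ : Equiv.Perm (Fin n)) :
    polarForm f (Fin.append a (fun j => b (τ j))) = polarForm f (Fin.append a b) := by
  set σ : Equiv.Perm (Fin (p + n)) :=
    finSumFinEquiv.permCongr (Equiv.sumCongr (Equiv.refl (Fin p)) τ) with hσ
  have h : (fun k => Fin.append a b (σ k)) = Fin.append a (fun j => b (τ j)) := by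
    funext k
    induction k using Fin.addCases with
    | left i => simp [hσ, Equiv.permCongr_apply]
    | right j => simp [hσ, Equiv.permCongr_apply]
  rw [← h, polarForm_perm]

/-- THE PREFIX POLYNOMIAL `g(x) = D(x,…,x)`, written out in the basis triads:
`g = Σ_r (Π_{i<p} a_i(r_i)) · P_f(e_r) · Π_{j} X_{r_{p+j}}`. [this cell] -/
noncomputable def prefixPoly (f : MvPolynomial (Pt N) ℂ) (a : Fin p → Pt N → ℂ) (n : ℕ) :
    MvPolynomial (Pt N) ℂ :=
  ∑ r : Fin (p + n) → Pt N,
    C ((∏ i : Fin p, a i (r (Fin.castAdd n i))) * polarForm f (fun k => basisTensor (r k)))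
      * ∏ j : Fin n, X (r (Fin.natAdd p j))

/-- The prefix polynomial is homogeneous of degree `n`. [this cell] -/
theorem prefixPoly_isHomogeneous (f : MvPolynomial (Pt N) ℂ) (a : Fin p → Pt N → ℂ) (n : ℕ) :
    (prefixPoly f a n).IsHomogeneous n := by
  apply IsHomogeneous.sum
  intro r _
  have h : IsHomogeneous (∏ j ∈ (univ : Finset (Fin n)), (X (r (Fin.natAdd p j)) : MvPolynomial (Pt N) ℂ))
      (∑ j ∈ (univ : Finset (Fin n)), 1) :=
    IsHomogeneous.prod univ _ (fun _ => 1) (fun j _ => isHomogeneous_X ℂ _)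
  have hn : (∑ j ∈ (univ : Finset (Fin n)), (1 : ℕ)) = n := by simp
  rw [hn] at h
  exact h.C_mul _

/-- The prefix polynomial IS the diagonal of the prefix form: `g(x) = D(x,…,x)`. [this cell] -/
theorem aeval_prefixPoly (f : MvPolynomial (Pt N) ℂ) (a : Fin p → Pt N → ℂ) (n : ℕ) (x : Pt N → ℂ) :
    aeval x (prefixPoly f a n) = polarForm f (Fin.append a (fun _ : Fin n => x)) := by
  rw [polarForm_expand, aeval_eq_eval_pt]
  simp only [prefixPoly, map_sum, map_mul, eval_C, map_prod, eval_X]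
  refine Finset.sum_congr rfl fun r _ => ?_
  rw [Fin.prod_univ_add]
  simp only [Fin.append_left, Fin.append_right]
  ring

/-- THE RE-POLARISATION IDENTITY `P_g(b) = n! · D(b)`: the polar form of the prefix polynomial is
`n!` times the prefix form. [this cell; permanent lemma + symmetry] -/
theorem polarForm_prefixPoly (f : MvPolynomial (Pt N) ℂ) (a : Fin p → Pt N → ℂ) (b : Fin n → Pt N → ℂ) :
    polarForm (prefixPoly f a n) b = (n.factorial : ℂ) * polarForm f (Fin.append a b) := by
  classical
  have h1 : polarForm (prefixPoly f a n) b
      = ∑ r : Fin (p + n) → Pt N,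
          ((∏ i : Fin p, a i (r (Fin.castAdd n i))) * polarForm f (fun k => basisTensor (r k)))
            * ∑ τ : Equiv.Perm (Fin n), ∏ j, b (τ j) (r (Fin.natAdd p j)) := by
    have e0 : polarForm (prefixPoly f a n) b = coeff (ones n) (aeval (slotTensor b) (prefixPoly f a n)) := rfl
    rw [e0]
    simp only [prefixPoly, map_sum, map_mul, aeval_C, algebraMap_eq, map_prod, aeval_X, coeff_sum]
    refine Finset.sum_congr rfl fun r _ => ?_
    rw [← map_prod C, ← map_mul C, coeff_C_mul, coeff_ones_prod_slotTensor]
  have h2 : ∀ τ : Equiv.Perm (Fin n), polarForm f (Fin.append a b)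
      = ∑ r : Fin (p + n) → Pt N,
          ((∏ i : Fin p, a i (r (Fin.castAdd n i))) * ∏ j, b (τ j) (r (Fin.natAdd p j)))
            * polarForm f (fun k => basisTensor (r k)) := by
    intro τ
    rw [← polarForm_append_perm f a b τ, polarForm_expand]
    refine Finset.sum_congr rfl fun r _ => ?_
    rw [Fin.prod_univ_add]
    simp only [Fin.append_left, Fin.append_right]
  rw [h1]
  calc ∑ r : Fin (p + n) → Pt N,
          ((∏ i : Fin p, a i (r (Fin.castAdd n i))) * polarForm f (fun k => basisTensor (r k)))
            * ∑ τ : Equiv.Perm (Fin n), ∏ j, b (τ j) (r (Fin.natAdd p j))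
      = ∑ τ : Equiv.Perm (Fin n), ∑ r : Fin (p + n) → Pt N,
          ((∏ i : Fin p, a i (r (Fin.castAdd n i))) * ∏ j, b (τ j) (r (Fin.natAdd p j)))
            * polarForm f (fun k => basisTensor (r k)) := by
        rw [Finset.sum_comm]
        refine Finset.sum_congr rfl fun r _ => ?_
        rw [Finset.mul_sum]
        refine Finset.sum_congr rfl fun τ _ => ?_
        ring
    _ = ∑ _τ : Equiv.Perm (Fin n), polarForm f (Fin.append a b) :=
        Finset.sum_congr rfl fun τ _ => (h2 τ).symm
    _ = (n.factorial : ℂ) * polarForm f (Fin.append a b) := sum_perm_const _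

/-- CONSEQUENCE: if the prefix polynomial vanishes identically, so does the prefix form.
[this cell; characteristic 0] -/
theorem append_eq_zero_of_prefixPoly (f : MvPolynomial (Pt N) ℂ) (a : Fin p → Pt N → ℂ)
    (h : prefixPoly f a n = 0) (b : Fin n → Pt N → ℂ) : polarForm f (Fin.append a b) = 0 := by
  have h1 := polarForm_prefixPoly f a b
  rw [h, polarForm_zero] at h1
  have hn : (n.factorial : ℂ) ≠ 0 := by exact_mod_cast Nat.factorial_ne_zero n
  exact (mul_eq_zero.mp h1.symm).resolve_left hn

end Summit.MatrixMultiplication.MatrixMultiplication.Theorems.ObstructionDescentPrefixForm
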